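import Summits.RiemannHypothesis.RiemannHypothesis.Theorems.WeilTwoPrimeDeflE25EBase
import Literature.NumberTheory.LFunctions.WeilBlockRows
import Literature.NumberTheory.LFunctions.WeilBlockRowsDCFast
import HarnessLib

/-!
# Even-sector deflated two-prime certificate E25E: rows 72–75 of the even check `D C = I`

`WeilCert.checkDCRow 0` for certificate E25E, row by row via the linear-traversal check `WeilCert.checkDCRowF` (`decide +kernel`) and `WeilCert.checkDCRow_of_F`. Pure proof file.
-/

set_option linter.dupNamespace false

noncomputable section

namespace Summit.RiemannHypothesis.RiemannHypothesis.Theorems.EvenWinsBeyondArch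

open Literature.NumberTheory.LFunctions

set_option maxHeartbeats 0 in
/-- Fast kernel check of row 72 of the even `D C = I` (certificate E25E; linear traversals). [folklore] -/
theorem checkDCRowF0_72_weilCertDeflE25E : weilCertDeflE25EBase.checkDCRowF 0 72 = true := by
  decide +kernel

/-- Row 72 of the even `D C = I` (certificate E25E), from the fast check. [folklore] -/
theorem checkDCRow0_72_weilCertDeflE25E : weilCertDeflE25EBase.checkDCRow 0 72 = true :=
  WeilCert.checkDCRow_of_F checkDCRowF0_72_weilCertDeflE25E

set_option maxHeartbeats 0 in
/-- Fast kernel check of row 73 of the even `D C = I` (certificate E25E; linear traversals). [folklore] -/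
theorem checkDCRowF0_73_weilCertDeflE25E : weilCertDeflE25EBase.checkDCRowF 0 73 = true := by
  decide +kernel

/-- Row 73 of the even `D C = I` (certificate E25E), from the fast check. [folklore] -/
theorem checkDCRow0_73_weilCertDeflE25E : weilCertDeflE25EBase.checkDCRow 0 73 = true :=
  WeilCert.checkDCRow_of_F checkDCRowF0_73_weilCertDeflE25E

set_option maxHeartbeats 0 in
/-- Fast kernel check of row 74 of the even `D C = I` (certificate E25E; linear traversals). [folklore] -/
theorem checkDCRowF0_74_weilCertDeflE25E : weilCertDeflE25EBase.checkDCRowF 0 74 = true := by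
  decide +kernel

/-- Row 74 of the even `D C = I` (certificate E25E), from the fast check. [folklore] -/
theorem checkDCRow0_74_weilCertDeflE25E : weilCertDeflE25EBase.checkDCRow 0 74 = true :=
  WeilCert.checkDCRow_of_F checkDCRowF0_74_weilCertDeflE25E

set_option maxHeartbeats 0 in
/-- Fast kernel check of row 75 of the even `D C = I` (certificate E25E; linear traversals). [folklore] -/
theorem checkDCRowF0_75_weilCertDeflE25E : weilCertDeflE25EBase.checkDCRowF 0 75 = true := by
  decide +kernel

/-- Row 75 of the even `D C = I` (certificate E25E), from the fast check. [folklore] -/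
theorem checkDCRow0_75_weilCertDeflE25E : weilCertDeflE25EBase.checkDCRow 0 75 = true :=
  WeilCert.checkDCRow_of_F checkDCRowF0_75_weilCertDeflE25E


end Summit.RiemannHypothesis.RiemannHypothesis.Theorems.EvenWinsBeyondArch
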